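import Summits.RiemannHypothesis.RiemannHypothesis.Theses.HardyZLehmerSplit
import Summits.RiemannHypothesis.RiemannHypothesis.Theorems.HardyZLehmerSplitDictionarystub_partialFraction
import Summits.RiemannHypothesis.RiemannHypothesis.Theorems.HardyZLehmerSplitDictionaryStubSmoothBound
import Summits.RiemannHypothesis.RiemannHypothesis.Theorems.HardyZLehmerSplitDictionarystub_clusterSigns
import Summits.RiemannHypothesis.RiemannHypothesis.Theorems.HardyZLehmerSplitDictionarystub_twoPoint
import Literature.NumberTheory.LFunctions.HardyZExtremaCriterionProofs
import Literature.NumberTheory.LFunctions.ZetaZeroWindowsExplicit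
import HarnessLib

/-!
# Dictionary_of_farField — composition of four landed stubs + hypothesis for stub B

This file assembles the `Dictionary` crux from the four landed stubs (A, C, D, E) and takes
`stub_farField` (stub B) as a hypothesis. When stub B lands, the final `Dictionary.lean` will
import this file and discharge the hypothesis.

## Landed stubs used

* stub A: `StubPartialFraction.stub_partialFraction` — partial-fraction decomposition of Z'/Z
* stub C: `StubSmoothBound.stub_smoothBound` — |smoothPart t| ≤ 3
* stub D: `stub_clusterSigns` — window sum bounds under pair-isolation
* stub E: `stub_twoPoint` — two-point sign change ⇒ Lehmer violation

## Composition

The proof of `Dictionary_of_farField` is transplanted from the skeleton `dictionary_v1.lean` l.323ff,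
using the landed stub names. The arithmetic is the budget table from Titchmarsh §9.6 (second proof):
pair contribution ≥ 1/δ − 2δ vs cluster + far + smooth ≤ L²/3 + 19L/6 + 4 + 20(L+1) + 50 + 3.
-/

noncomputable section

open Complex Set Filter Topology
open Literature.NumberTheory.LFunctions

namespace DictionaryAssembly

/-! ## Bridge lemma for smoothPart defeq -/

/-- The `smoothPart` in `StubSmoothBound` is definitionally equal to the root `smoothPart`. -/
theorem smoothPart_eq : StubSmoothBound.smoothPart = smoothPart := rfl

/-! ## Glue (from skeleton dictionary_v1.lean l.263–314) -/

/-- Under pair-isolation at radius `R` with `δ ≠ 0`, `Z` has no zero within `R` of `γ`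
(a zero of `Z` is a zero of ζ ON the line, `hardyZ_eq_zero_iff_holds`). -/
theorem hardyZ_ne_zero_of_isolated {γ δ R u : ℝ} (hδ : 0 < δ)
    (hiso : ∀ s : ℂ, riemannZeta s = 0 → 0 < s.re → s.re < 1 → |s.im - γ| < R →
      s.im = γ ∧ (s.re = 1 / 2 + δ ∨ s.re = 1 / 2 - δ))
    (hu : |u - γ| < R) : hardyZ u ≠ 0 := by
  intro hZ
  have hz : riemannZeta (1 / 2 + u * I) = 0 := (hardyZ_eq_zero_iff_holds u).1 hZ
  have h := hiso (1 / 2 + u * I) hz (by simp) (by simp; norm_num) (by simpa using hu)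
  rcases h.2 with h1 | h1 <;> simp at h1 <;> linarith

/-- `28 ≤ log γ` for `γ > 3 000 175 332 800` (`e < 2.72`, `2.72²⁸ < 3·10¹²`). -/
theorem log_ge_28 {γ : ℝ} (hγ : 3000175332800 < γ) : 28 ≤ Real.log γ := by
  have hγpos : 0 < γ := by linarith
  rw [Real.le_log_iff_exp_le hγpos]
  have h1 := Real.exp_one_lt_d9
  have e : Real.exp 28 = Real.exp 1 ^ 28 := by rw [← Real.exp_nat_mul]; norm_num
  rw [e]
  have h2 : Real.exp 1 ^ 28 < (2.72 : ℝ) ^ 28 :=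
    pow_lt_pow_left₀ (by linarith) (Real.exp_pos 1).le (by norm_num)
  have h3 : (2.72 : ℝ) ^ 28 < 3000175332800 := by norm_num
  linarith

/-- The explicit window law of the tree, in the shape used twice below: for `t ≥ 31` with
`t + 1 ≤ 2γ`, `N(t+1) − N(t−1) ≤ log γ + 8` (`ZetaZeroWindows.count_diff_le_explicit`, T = t−1, H = 2;
`(1/π) log((t+1)/2π) + 0.6166 log(t+1) + 6.506 ≤ 0.95 (log γ + 1) + 6.51`). -/
theorem window_count_le {γ t : ℝ} (hγ : 1 ≤ γ) (ht : 31 ≤ t) (htγ : t + 1 ≤ 2 * γ) :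
    (zetaZeroCount (t + 1) : ℝ) - zetaZeroCount (t - 1) ≤ Real.log γ + 8 := by
  have hπ3 := Real.pi_gt_three
  have hπpos := Real.pi_pos
  have hcnt := ZetaZeroWindows.count_diff_le_explicit (T := t - 1) (H := 2) (by linarith) (by norm_num)
  have e1 : t - 1 + 2 = t + 1 := by ring
  rw [e1] at hcnt
  have hlog2 : Real.log 2 ≤ 1 := by have := Real.log_two_lt_d9; linarith
  have hL0 : 0 ≤ Real.log γ := Real.log_nonneg hγ
  have hlt1 : Real.log (t + 1) ≤ Real.log γ + 1 := by
    have h1 : Real.log (t + 1) ≤ Real.log (2 * γ) := Real.log_le_log (by linarith) htγ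
    rw [Real.log_mul (by norm_num) (by linarith)] at h1
    linarith
  have hlt0 : 0 ≤ Real.log (t + 1) := Real.log_nonneg (by linarith)
  have hq : Real.log ((t + 1) / (2 * Real.pi)) ≤ Real.log (t + 1) := by
    refine Real.log_le_log (by positivity) ?_
    exact div_le_self (by linarith) (by linarith)
  have hc : 2 / (2 * Real.pi) ≤ 1 / 3 := by
    rw [div_le_div_iff₀ (by positivity) (by norm_num)]
    linarith
  have hc0 : 0 ≤ 2 / (2 * Real.pi) := by positivity
  have i1 : 2 / (2 * Real.pi) * Real.log ((t + 1) / (2 * Real.pi)) ≤ 1 / 3 * Real.log (t + 1) := by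
    calc 2 / (2 * Real.pi) * Real.log ((t + 1) / (2 * Real.pi))
        ≤ 2 / (2 * Real.pi) * Real.log (t + 1) := mul_le_mul_of_nonneg_left hq hc0
      _ ≤ 1 / 3 * Real.log (t + 1) := mul_le_mul_of_nonneg_right hc hlt0
  linarith

set_option maxHeartbeats 400000 in
open Summit.RiemannHypothesis.RiemannHypothesis.Theses in
/-- **COMPOSITION: the four landed stubs + hypothesis stub B ⇒ `HardyZLehmerSplit.Dictionary`**.

Stub B (`stub_farField : ∀ t : ℝ, 100 ≤ t → |farSum t| ≤ 20 * Real.log t + 50`) is taken as a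
hypothesis `hB`. When stub B lands, import its module and apply this theorem to close the crux. -/
theorem Dictionary_of_farField
    (hB : ∀ t : ℝ, 100 ≤ t → |farSum t| ≤ 20 * Real.log t + 50) :
    HardyZLehmerSplit.Dictionary := by
  have hA := StubPartialFraction.stub_partialFraction
  have hC := StubSmoothBound.stub_smoothBound
  have hD := stub_clusterSigns
  have hE := stub_twoPoint
  -- Bridge for smoothPart: StubSmoothBound.smoothPart = smoothPart by rfl
  have hC' : ∀ t : ℝ, 100 ≤ t → |smoothPart t| ≤ 3 := by
    intro t ht
    rw [← smoothPart_eq]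
    exact hC t ht
  intro γ δ hγ hδ hδhalf hzero hthin hiso
  have hγpos : 0 < γ := by linarith
  have hL28 : 28 ≤ Real.log γ := log_ge_28 hγ
  set L := Real.log γ with hLdef
  have hLpos : 0 < L := by linarith
  have hπ3 := Real.pi_gt_three
  have hπ314 := Real.pi_gt_d2
  have hπpos : 0 < Real.pi := Real.pi_pos
  -- thinness consequences
  have hb1 : δ * L ^ 2 ≤ 1 / 4 := hthin
  have hb2 : δ * L ≤ 1 / 112 := by
    have : δ * L * 28 ≤ δ * L * L := mul_le_mul_of_nonneg_left hL28 (by positivity)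
    nlinarith
  have hb3 : δ ≤ 1 / 3136 := by
    have : δ * 784 ≤ δ * L ^ 2 := mul_le_mul_of_nonneg_left (by nlinarith) hδ.le
    linarith
  have hinv : 4 * L ^ 2 ≤ 1 / δ := by
    rw [le_div_iff₀ hδ]
    linarith
  have hL2 : 28 * L ≤ L ^ 2 := by nlinarith
  -- the isolation radius r = π / L
  set r := Real.pi / L with hrdef
  have hrpos : 0 < r := by positivity
  have hLr : L * r = Real.pi := by rw [hrdef]; field_simp
  have h2δ : 2 * δ ≤ r := by
    have : 2 * δ * L ≤ r * L := by linarith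
    exact le_of_mul_le_mul_right this hLpos
  have hδr : δ < r := by linarith
  have hrδ : 0 < r - δ := by linarith
  have hker : 1 / (r - δ) ≤ L / 3 := by
    rw [div_le_div_iff₀ hrδ (by norm_num)]
    have e : L * (r - δ) = Real.pi - δ * L := by rw [mul_sub, hLr]; ring
    linarith
  have hfac : 1 / (r - δ) + 1 / 2 ≤ L / 3 + 1 / 2 := by linarith
  have hfac0 : 0 ≤ 1 / (r - δ) + 1 / 2 := by positivity
  -- `Z ≠ 0` on `[γ − δ, γ + δ]`, hence `ζ(½ + i(γ ± δ)) ≠ 0`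
  have hZne : ∀ u ∈ Set.Icc (γ - δ) (γ + δ), hardyZ u ≠ 0 := by
    intro u hu
    refine hardyZ_ne_zero_of_isolated hδ hiso ?_
    have : |u - γ| ≤ δ := abs_le.mpr ⟨by linarith [hu.1], by linarith [hu.2]⟩
    linarith
  have hζp : riemannZeta (1 / 2 + ((γ + δ : ℝ) : ℂ) * I) ≠ 0 := fun h0 ↦
    hZne (γ + δ) ⟨by linarith, le_rfl⟩ ((hardyZ_eq_zero_iff_holds (γ + δ)).2 h0)
  have hζm : riemannZeta (1 / 2 + ((γ - δ : ℝ) : ℂ) * I) ≠ 0 := fun h0 ↦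
    hZne (γ - δ) ⟨le_rfl, by linarith⟩ ((hardyZ_eq_zero_iff_holds (γ - δ)).2 h0)
  -- logarithms at `γ ± δ`
  have hlog2 : Real.log 2 ≤ 1 := by have := Real.log_two_lt_d9; linarith
  have hlogp : Real.log (γ + δ) ≤ L + 1 := by
    have h1 : Real.log (γ + δ) ≤ Real.log (2 * γ) := Real.log_le_log (by linarith) (by linarith)
    rw [Real.log_mul (by norm_num) hγpos.ne'] at h1
    linarith
  have hlogm : Real.log (γ - δ) ≤ L + 1 := by
    have h1 : Real.log (γ - δ) ≤ Real.log γ := Real.log_le_log (by linarith) (by linarith)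
    linarith
  -- the five inputs at `t = γ ± δ`
  obtain ⟨-, hdecp⟩ := hA (γ + δ) (by linarith) hζp
  obtain ⟨-, hdecm⟩ := hA (γ - δ) (by linarith) hζm
  have hfarp := (abs_le.mp (hB (γ + δ) (by linarith))).1
  have hfarm := (abs_le.mp (hB (γ - δ) (by linarith))).2
  have hsmp := (abs_le.mp (hC' (γ + δ) (by linarith))).1
  have hsmm := (abs_le.mp (hC' (γ - δ) (by linarith))).2
  obtain ⟨hplus, hminus⟩ :=
    hD γ δ r (by linarith) hδ hδhalf h2δ hzero hiso
  -- window counts BY NAME (`ZetaZeroWindows.count_diff_le_explicit`)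
  have hWp : (zetaZeroCount (γ + δ + 1) : ℝ) - zetaZeroCount (γ + δ - 1) ≤ L + 8 :=
    window_count_le (γ := γ) (t := γ + δ) (by linarith) (by linarith) (by linarith)
  have hWm : (zetaZeroCount (γ - δ + 1) : ℝ) - zetaZeroCount (γ - δ - 1) ≤ L + 8 :=
    window_count_le (γ := γ) (t := γ - δ) (by linarith) (by linarith) (by linarith)
  have hWp0 : 0 ≤ (zetaZeroCount (γ + δ + 1) : ℝ) - zetaZeroCount (γ + δ - 1) := by
    have : (zetaZeroCount (γ + δ - 1) : ℝ) ≤ zetaZeroCount (γ + δ + 1) := by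
      exact_mod_cast zetaZeroCount_mono (by linarith : γ + δ - 1 ≤ γ + δ + 1)
    linarith
  have hWm0 : 0 ≤ (zetaZeroCount (γ - δ + 1) : ℝ) - zetaZeroCount (γ - δ - 1) := by
    have : (zetaZeroCount (γ - δ - 1) : ℝ) ≤ zetaZeroCount (γ - δ + 1) := by
      exact_mod_cast zetaZeroCount_mono (by linarith : γ - δ - 1 ≤ γ - δ + 1)
    linarith
  have hexp : (L + 8) * (L / 3 + 1 / 2) = L ^ 2 / 3 + 19 * L / 6 + 4 := by ring
  have hclp : ((zetaZeroCount (γ + δ + 1) : ℝ) - zetaZeroCount (γ + δ - 1)) * (1 / (r - δ) + 1 / 2)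
      ≤ L ^ 2 / 3 + 19 * L / 6 + 4 := by
    rw [← hexp]; exact mul_le_mul hWp hfac hfac0 (by linarith)
  have hclm : ((zetaZeroCount (γ - δ + 1) : ℝ) - zetaZeroCount (γ - δ - 1)) * (1 / (r - δ) + 1 / 2)
      ≤ L ^ 2 / 3 + 19 * L / 6 + 4 := by
    rw [← hexp]; exact mul_le_mul hWm hfac hfac0 (by linarith)
  -- the budget: `Z'/Z(γ+δ) > 0`, `Z'/Z(γ−δ) < 0`
  have hpos : 0 < deriv hardyZ (γ + δ) / hardyZ (γ + δ) := by
    rw [hdecp]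
    linarith
  have hneg : deriv hardyZ (γ - δ) / hardyZ (γ - δ) < 0 := by
    rw [hdecm]
    linarith
  obtain ⟨t, ht, hviol⟩ := hE (γ - δ) (γ + δ) (by linarith) hZne hneg hpos
  refine ⟨t, ?_, hviol⟩
  have : |t - γ| < δ := abs_lt.mpr ⟨by linarith [ht.1], by linarith [ht.2]⟩
  linarith

end DictionaryAssembly
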